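import Summits.HodgeConjecture.FermatCycles.ConditionQCoprimeSix
import Literature.AlgebraicGeometry.Shioda1982.StandardElementsHodge
import HarnessLib

/-!
# Shioda's Theorem 6 (a) from Theorem K-R (a) via Proposition 5: the symmetry of `M'ₘ` from ONE printed input (part 3 of the by-product)

HONEST FRAMING: explicit algebraic cycles for specific Hodge classes on Fermat/Delsarte varieties;
residual open instances listed; no claim on general Hodge.

Topic path `Summits/HodgeConjecture/FermatCycles/` of cell `pub-hfermat`; sequel to `ConditionQSymmetric.lean` (part 1: under INPUT 1 = Theorem K-R (a)
and INPUT 2 = Theorem 6 (a) of [Shioda1982PicardFermat], every element of `M'ₘ` is symmetric) and `ConditionQCoprimeSix.lean` (part 2: hence `¬(Q⁴ₘ)` for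
`5 ∣ m`, and `(Qₘ) ⟺ (Pₘ) ⟺ m` prime for `gcd(m, 6) = 1`). Both parts carried the two inputs as explicit section hypotheses `hKR`, `h6a`.

THIS FILE removes INPUT 2: [Shioda1982PicardFermat, §7 p. 731] deduces Theorem 6 (a) "immediately" from Proposition 5 (p. 730) and Theorem K-R (a),
and we formalize exactly that deduction (`h6a_of_KR`, stated in the shape of the hypothesis `h6a` of parts 1–2). PROPOSITION 5 (p. 730, proof): for `α = (a₀, a₁, a₂, a₃) ∈ 𝔅²ₘ` with
`a₀ + a₁ ≢ 0`, put `β = (a₀, a₁, −a₀−a₁)`, `γ = (−a₂, −a₃, −a₀−a₁) ∈ 𝔄^{1,0}ₘ`; since `α ∈ 𝔅²ₘ`, `|t·β| + |−t·γ| = |t·α| + 1 = 3` for every unit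
`t`, so `H_β = H_γ`; Theorem K-R (a) then makes `β` a permutation of `γ`, i.e. `{a₂, a₃} = {−a₀, −a₁}`: `α` is decomposable. In the tree's
vocabulary this is one application of part 1's `semi_eq_map_neg` (which is Proposition 5's computation followed by `hKR`) to the zero-sum triples
`t = (−(a+b), a, b)` and `u = (a+b, c, d)`, whose juxtaposition `t + u = {a+b, −(a+b)} + q` is a Hodge multiset.

CONSEQUENCES (`consequences_of_KR`, one conjunction; or feed `h6a_of_KR hKR` to any theorem of parts 1–2): all results of parts 1–2 under the SINGLE hypothesis `hKR` (= [Shioda1982PicardFermat] Thm K-R (a) p. 730 =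
[KoblitzRohrlich1978] Thm 1 (i), a theorem in print for `gcd(m, 6) = 1`): `M'ₘ` is symmetric; `(Qⁿₘ)` fails for `n ≥ p − 1` when an odd `p ≥ 5`
divides `m` with `m/p ≥ 3`; `(Q⁴ₘ)` fails for `5 ∣ m`, `m ≥ 15`; and for `gcd(m, 6) = 1`, `(Qₘ) ⟺ m` prime `⟺ (Pₘ)`.
SCOPE CHECK (`three_not_dvd_of_KR`, `two_not_dvd_of_KR`, `coprime_six_of_KR`): the hypothesis `hKR` is FALSE when `3 ∣ m`, `m ≥ 9` — Aoki's
`σ_{3,1} = (1, 1+d, 1+2d, −3)` is then a Hodge QUADRUPLE, hence in `M'ₘ`, but not symmetric — and FALSE when `2 ∣ m`, `m ≥ 6` — Shioda's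
`α₁ = L₁ = (1, m′, m′+1, m−2)` ([Shioda1982PicardFermat, Lemma 1 (a)], tree `Shioda1982.isHodgeMultiset_stdOne`, `not_exists_eq_pairs_stdOne`) is then an
indecomposable Hodge quadruple, contradicting Theorem 6 (a) = `h6a_of_KR`. So for `m ≥ 6` the input FORCES `gcd(m, 6) = 1` — exactly the printed scope of
Theorem K-R (a) (for `m = 3ⁿ, 2ⁿ` see Thm K-R (b₁), (c₁)) — and `scope_and_answer_of_KR` states the answer to Shioda's question with no coprimality hypothesis.

References: [Shioda1982PicardFermat] T. Shioda, On the Picard number of a Fermat surface, J. Fac. Sci. Univ. Tokyo IA 28 (1982) 725–734: Prop. 5 and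
Thm K-R p. 730, Thm 6 p. 731 (scan read, `HOME/lit/scans/Shioda1982/page06–07.png`); [KoblitzRohrlich1978] N. Koblitz, D. Rohrlich, Simple factors in the
Jacobian of a Fermat curve, Canad. J. Math. 30 (1978) 1183–1205, Thm 1 p. 1185; [Shioda1979HodgeFermat] T. Shioda, Math. Ann. 245 (1979) §4 pp. 183–184;
[Shioda1981FermatType] T. Shioda, Math. Ann. 258 (1981), Appendix pp. 78–79; [Aoki1987] N. Aoki, J. Math. Soc. Japan 39 (1987) §1 p. 387.
-/

namespace Summit.HodgeConjecture.FermatCycles.ConditionQKoblitzRohrlich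

open Summit.HodgeConjecture.FermatCycles.ConditionQSymmetric Summit.HodgeConjecture.FermatCycles.ConditionQCoprimeSix

open Multiset
open Literature.AlgebraicGeometry.HodgeTheory Literature.AlgebraicGeometry.HodgeTheory.FermatCharacter
open Literature.AlgebraicGeometry.Shioda1979 Literature.AlgebraicGeometry.Shioda1981
open Literature.AlgebraicGeometry.Shioda1982 (isHodgeMultiset_stdOne card_stdOne not_exists_eq_pairs_stdOne)

variable {m : ℕ}

section KR

variable (hKR : ∀ β γ : Multiset (ZMod m), card β = 3 → card γ = 3 → (∀ x ∈ β, x ≠ 0) → (∀ x ∈ γ, x ≠ 0) →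
    mNormSum β = m → mNormSum γ = m →
    (∀ t : (ZMod m)ˣ, mNormSum (β.map fun a ↦ (t : ZMod m) * a) = m ↔ mNormSum (γ.map fun a ↦ (t : ZMod m) * a) = m) → β = γ)

include hKR

/-! ### Theorem 6 (a) from Proposition 5 and Theorem K-R (a) -/

/-- **[Shioda1982PicardFermat, Thm 6 (a)] from Thm K-R (a), via Prop. 5**: under INPUT 1, every Hodge quadruple is `{a, −a} + {b, −b}`
(there are no indecomposable elements of `𝔅²ₘ`). If `a + b = 0` then `c + d = 0` and we are done; otherwise `t = (−(a+b), a, b)` and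
`u = (a+b, c, d)` are zero-sum triples with `t + u = {a+b, −(a+b)} + {a, b, c, d}` Hodge, so part 1's `semi_eq_map_neg` (Prop. 5's norm
computation + Thm K-R (a)) gives `u = −t`, i.e. `{c, d} = {−a, −b}`. Stated in the shape of the hypothesis `h6a` of parts 1–2 (INPUT 2 is a
consequence of INPUT 1, "From Proposition 5 and Theorem K-R", §7 p. 731). [cite: Shioda1982PicardFermat, Prop. 5 p. 730, §7 Thm 6 (a) p. 731] -/
theorem h6a_of_KR [NeZero m] :
    ∀ q : Multiset (ZMod m), IsHodgeMultiset q → card q = 4 → ∃ a b : ZMod m, q = {a, -a} + {b, -b} := by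
  intro q hq h4
  obtain ⟨a, b, c, d, rfl⟩ := Multiset.card_eq_four.mp h4
  have h0 := hq.1.1
  have hsum : a + b + c + d = 0 := by
    have := hq.1.2
    simp only [insert_eq_cons, sum_cons, sum_singleton] at this
    linear_combination this
  by_cases hab : a + b = 0
  · -- `α` is decomposable on the nose
    have hb : b = -a := by linear_combination hab
    have hd : d = -c := by linear_combination hsum - hab
    subst hb hd
    exact ⟨a, c, by simp only [insert_eq_cons, cons_add, singleton_add]⟩
  · -- Proposition 5: `t = (−(a+b), a, b)`, `u = (a+b, c, d)`
    have hH : IsHodgeMultiset ((-(a + b)) ::ₘ a ::ₘ {b} + ((a + b) ::ₘ c ::ₘ {d})) := by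
      have hp := (IsHodgeMultiset.pair hab).add hq
      have e : (-(a + b)) ::ₘ a ::ₘ {b} + ((a + b) ::ₘ c ::ₘ {d}) = ({a + b, -(a + b)} + {a, b, c, d} : Multiset (ZMod m)) := by
        simp only [insert_eq_cons, cons_add, singleton_add]
        rw [Multiset.cons_swap b (a + b), Multiset.cons_swap a (a + b), Multiset.cons_swap (-(a + b)) (a + b)]
      rw [e]
      exact hp
    have key := semi_eq_map_neg hKR (t := (-(a + b)) ::ₘ a ::ₘ {b}) (u := (a + b) ::ₘ c ::ₘ {d})
      (by simp) (by simp) (by simp) hH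
    simp only [map_cons, map_singleton, neg_neg] at key
    have hcd : c ::ₘ ({d} : Multiset (ZMod m)) = (-a) ::ₘ {-b} := (Multiset.cons_inj_right _).mp key
    refine ⟨a, b, ?_⟩
    simp only [insert_eq_cons]
    rw [hcd, cons_add, singleton_add, Multiset.cons_swap b (-a)]

/-! ### Parts 1–2 under the single input -/

/-- **Parts 1–2 granted Theorem K-R (a) at `m` alone** (feed `h6a_of_KR hKR` for their second hypothesis; collected here as one statement):
(i) every element of `M'ₘ` is symmetric (`ConditionQSymmetric.mPrime_symmetric`); (ii) `(Qⁿₘ)` fails for `n ≥ p − 1` whenever an odd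
`p = 2r+1 ≥ 5` divides `m` with `m/p ≥ 3` (`ConditionQCoprimeSix.not_conditionQ_of_odd_dvd`); (iii) in particular `(Q⁴ₘ)` fails for `5 ∣ m`,
`m ≥ 15` — in print (`gcd(m, 6) = 1`) for `m = 25, 35, 55, 65, 85, 95, 115, …`; (iv) for `m` prime to `6`: `(Qₘ) ⟺ m` prime `⟺ (Pₘ)` — Shioda's
question "(Qₘ) but not (Pₘ)?" has a negative answer for every such `m`. [cite: Shioda1979HodgeFermat, §4 pp. 183–184 (conditions (Pₘ), (Qₘ), the question)]
[cite: Shioda1981FermatType, Appendix pp. 78–79 (m = 25)] [cite: Shioda1982PicardFermat, Thm K-R (a) p. 730] [cite: KoblitzRohrlich1978, Thm 1 p. 1185] -/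
theorem consequences_of_KR [NeZero m] :
    (∀ ξ ∈ MPrime m, IsSymmetric ξ) ∧
    (∀ r n : ℕ, 2 ≤ r → 2 * r + 1 ∣ m → 3 ≤ m / (2 * r + 1) → 2 * r ≤ n → ¬ ConditionQ m n) ∧
    (5 ∣ m → 15 ≤ m → ¬ ConditionQ m 4) ∧
    (Nat.Coprime m 6 → 1 < m → (ConditionQAll m ↔ m.Prime) ∧ (ConditionQAll m ↔ ShiodaCondition m)) :=
  ⟨mPrime_symmetric hKR (h6a_of_KR hKR),
    fun _ _ hr hpm hd hn ↦ not_conditionQ_of_odd_dvd hKR (h6a_of_KR hKR) hr hpm hd hn,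
    fun h5 hm ↦ not_conditionQ_four_of_five_dvd hKR (h6a_of_KR hKR) h5 hm,
    fun h6 h1 ↦ ⟨conditionQAll_iff_prime hKR (h6a_of_KR hKR) h6 h1, conditionQAll_iff_shiodaCondition_of_inputs hKR (h6a_of_KR hKR) h6 h1⟩⟩

/-! ### Scope check: the input fails when `3 ∣ m` -/

/-- **The hypothesis `hKR` is false when `3 ∣ m`, `m ≥ 9`**: Aoki's `σ_{3,1} = (1, 1+d, 1+2d, −3)` (`d = m/3 ≥ 3`) is a Hodge quadruple, hence
`{a, −a} + {b, −b}` by `h6a_of_KR`, hence symmetric — but it contains `1` and not `−1`. (Theorem K-R (a) is printed for `gcd(m, 6) = 1`;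
for `m = 3ⁿ` Theorem K-R (b₁) lists the genuinely different pairs `β, γ` with `H_β = H_γ`.) [cite: Shioda1982PicardFermat, Thm K-R p. 730]
[cite: Aoki1987, §1 p. 387] -/
theorem three_not_dvd_of_KR [NeZero m] (hm : 9 ≤ m) : ¬ 3 ∣ m := fun h3 ↦ by
  have hd : 3 ≤ m / (2 * 1 + 1) := by show 3 ≤ m / 3; omega
  obtain ⟨a, b, hab⟩ := h6a_of_KR hKR _ (isHodgeMultiset_aokiStandard_one (r := 1) h3 (by omega)) (card_aokiStandard_one 1)
  refine not_isSymmetric_aokiStandard_one (r := 1) le_rfl h3 hd ?_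
  rw [hab]
  exact isSymmetric_add (isSymmetric_pair a) (isSymmetric_pair b)

/-! ### Scope check: the input fails when `2 ∣ m`; for `m ≥ 6` it forces `gcd(m, 6) = 1` -/

/-- **The hypothesis `hKR` is false when `2 ∣ m`, `m ≥ 6`**: Shioda's `α₁ = L₁ = (1, m′, m′+1, m−2)` is a Hodge quadruple
([Shioda1982PicardFermat, Lemma 1 (a)]) which is not `{a, −a} + {b, −b}` (it contains `1`, not `−1`), contradicting `h6a_of_KR`.
(Theorem K-R (a) is printed for `gcd(m, 6) = 1`; for `m = 2ⁿ` Theorem K-R (c₁) lists the genuinely different pairs.)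
[cite: Shioda1982PicardFermat, Lemma 1 (a) p. 728, Thm K-R p. 730] -/
theorem two_not_dvd_of_KR [NeZero m] (hm : 6 ≤ m) : ¬ 2 ∣ m := fun h2 ↦
  not_exists_eq_pairs_stdOne h2 hm (h6a_of_KR hKR _ (isHodgeMultiset_stdOne h2 hm) card_stdOne)

/-- **For `m ≥ 6` the input forces `gcd(m, 6) = 1`** — the printed scope of Theorem K-R (a). [cite: Shioda1982PicardFermat, Thm K-R (a) p. 730] -/
theorem coprime_six_of_KR [NeZero m] (hm : 6 ≤ m) : Nat.Coprime m 6 := by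
  have h2 := two_not_dvd_of_KR hKR hm
  have h3 : ¬ 3 ∣ m := fun h3 ↦ three_not_dvd_of_KR hKR (by omega) h3
  have h2' : Nat.Coprime m 2 := ((Nat.Prime.coprime_iff_not_dvd Nat.prime_two).2 h2).symm
  have h3' : Nat.Coprime m 3 := ((Nat.Prime.coprime_iff_not_dvd Nat.prime_three).2 h3).symm
  have h := Nat.Coprime.mul_right h2' h3'
  norm_num at h
  exact h

/-- **Shioda's question, granted Theorem K-R (a) at `m ≥ 6`, with no coprimality hypothesis** (it is forced): `gcd(m, 6) = 1`, and
`(Qₘ) ⟺ m` prime `⟺ (Pₘ)`. [cite: Shioda1979HodgeFermat, §4 p. 184 (the question)] [cite: Shioda1982PicardFermat, Thm K-R (a) p. 730] -/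
theorem scope_and_answer_of_KR [NeZero m] (hm : 6 ≤ m) :
    Nat.Coprime m 6 ∧ (ConditionQAll m ↔ m.Prime) ∧ (ConditionQAll m ↔ ShiodaCondition m) :=
  have h6 := coprime_six_of_KR hKR hm
  ⟨h6, conditionQAll_iff_prime hKR (h6a_of_KR hKR) h6 (by omega),
    conditionQAll_iff_shiodaCondition_of_inputs hKR (h6a_of_KR hKR) h6 (by omega)⟩

end KR

end Summit.HodgeConjecture.FermatCycles.ConditionQKoblitzRohrlich
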